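import Literature.MathematicalPhysics.QuantumFieldTheory.Balaban1983to89.Beta.MarginalTelescoping

/-!
# `Balaban1983to89.Beta.ReplacementRates` — the PRINTED SHAPES of [B12]'s replacement / irrelevant-term estimates are
geometric in the scale separation `k − j`: adapters into `MarginalTelescoping.SeparationRate` (β sub-cell, row an4;
record `HOME/BETA/O4-TERMS.md`)

HONEST FRAMING (page 1 of everything in the β sub-cell).  Discharging `BetaPertH` makes Bałaban's UV stability
UNCONDITIONAL — a real constructive-QFT result; it is NOT the continuum limit and NOT the Clay problem.  This module
discharges nothing: it is SHAPE ALGEBRA over abstract real families, with every analytic input a binder.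

WHAT THIS MODULE IS.  [B12] = Bałaban, Commun. Math. Phys. 109 (1987) 249–301, §4 pp. 290–292 replaces, inside the
localized second-order expansion (4.34) of the carried terms, `H_j(□₀)` by `H_j` with free boundary conditions, the
`y`-sums over `supp ζ̃_□` by sums over `ℤ⁴`, and the sums over localization domains `X ⊂ □̃²` by sums over all
`X ∈ 𝐃⁰_j` ((4.35)–(4.37)); the same for the carried counterterm (4.38) ((4.39)–(4.40)).  The PRINTED bound shapes of the
differences are (p. 290, after (4.35)) «the factor B₀ exp(−δ₀M(Lʲη)⁻¹)» and (4.36)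
«≤ O(1)E₀ exp(−(Lʲη)⁻¹) exp(−δ₁|x − y|)», and the generic irrelevant terms carry «O(1)(Lʲη)^{4+α} exp(−κd_j(X)), α > 0»
((0.29) p. 258), summed over `j` uniformly in `k` by «(1 − L^{−α})⁻¹» ((0.30) p. 258).  With the paper's scale
conventions (`η = L^{−k}`, so `Lᵏη = 1`; p. 279 «Let us notice that j ≤ k, hence Lʲη ≤ 1») one has `(Lʲη)⁻¹ = L^{k−j}`, so these shapes read
`C · exp(−a · L^{k−j})` and `C · (L^{k−j})^{−α}` in the scale separation `n = k − j`.

The cell's composed road types the old-term discrepancies through `MarginalTelescoping.SeparationRate C θ μ β0 :=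
∀ j < k, |μ j k − β0 j| ≤ C θ^{k−j}` (BETA-SPEC §7.18 (d)(R11-2) item (O4): «under the alternative typing (A) the same
terms would give `SeparationRate C θ` PROVIDED their printed bounds are geometric in k − j»).  This file proves the
proviso as pure real analysis:

* §1 `exp_tower_le_geom` — `exp(−a·Lⁿ) ≤ (exp(−a))ⁿ` for `0 ≤ a`, `2 ≤ L` (the tower shape is AT LEAST geometric,
  ratio `e^{−a}`), and `pow_scale_rpow_neg` — `(Lⁿ)^{−α} = (L^{−α})ⁿ` (the (0.29) shape IS geometric, ratio `L^{−α}`);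
  both ratios lie in `[0,1[` for `a > 0`, resp. `1 < L`, `α > 0`.
* §2 adapters: a family whose discrepancies obey the printed tower shape, resp. the printed power shape, satisfies
  `SeparationRate` with the displayed `(C, θ)`; `SeparationRate` is monotone in `(C, θ)` and additive over finitely many
  groups of terms (two groups; iterate), so a table of named terms with these shapes assembles into ONE `SeparationRate`.
* §3 the uniform-in-`k` `j`-sums — the property [B12] p. 292 l. 2–5 says the marginal terms (4.42), (4.44) LACK
  («for which the sum over j has not a uniform bound») and p. 298 l. 12–16 affirms for the transformed action («a
  uniform bound is clear»):
  `Σ_{j<k} C exp(−a L^{k−j}) ≤ C e^{−a}/(1 − e^{−a})` and `Σ_{j<k} C (L^{k−j})^{−α} ≤ C L^{−α}/(1 − L^{−α})`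
  (cf. (0.30)'s «(1 − L^{−α})⁻¹»), via `MarginalTelescoping.sum_pow_sub_le`.
  (v1.0.1 DOCFIX, XREAD ref5-g13 2026-08-19T01:01:11Z remark R2, GAPS C-ref5-99: v1 attributed the affirmative phrase
  to p. 292; kernel content byte-identical to v1 p181789.)

WHAT THIS MODULE IS NOT.  It does NOT assert that any of Bałaban's differences obeys these shapes (that is the printed
claim of [B12] p. 290 / (4.36), LOCATED in `HOME/BETA/O4-TERMS.md`, never used here), nor that the marginal-coefficient
discrepancy of a carried term inherits the shape of the kernel bound (the second-moment extraction costs a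
`δ₁`-dependent constant, p. 286 «δ₁ = O(M⁻¹)»; not displayed in print).  Every hypothesis below is a binder on abstract
families `μ : ℕ → ℕ → ℝ`, `β0 : ℕ → ℝ`; nothing printed is quoted as a fact; no `sorry`.

Sources (locators only, quotations verbatim from the renders `1987-cmp109-rg-I-small-field-p010/p031/p038/p042/p043/p044/p050`):
[B12] (0.29)–(0.30) p. 258; p. 279 l. 15; p. 286 (4.22) and «δ₁ = O(M⁻¹)»; p. 290 ll. 12–22 and (4.36); p. 291 (4.37)–(4.40);
p. 292 l. 2–9; p. 298 ll. 12–16 (render p050).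
-/

namespace Literature.MathematicalPhysics.QuantumFieldTheory.Balaban1983to89.Beta.ReplacementRates

open Real Finset
open Literature.MathematicalPhysics.QuantumFieldTheory.Balaban1983to89.Beta.MarginalTelescoping
  (SeparationRate sum_pow_sub_le)

/-! ## 1. The two printed shapes are (at least) geometric in the scale separation -/

/-- `n ≤ Lⁿ` for `2 ≤ L` (real `L`). [folklore] -/
theorem natCast_le_pow {L : ℝ} (hL : 2 ≤ L) (n : ℕ) : (n : ℝ) ≤ L ^ n := by
  have h1 : (n : ℝ) < (2 : ℝ) ^ n := by exact_mod_cast Nat.lt_two_pow_self (n := n)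
  have h2 : (2 : ℝ) ^ n ≤ L ^ n := pow_le_pow_left₀ (by norm_num) hL n
  exact (h1.le).trans h2

/-- THE TOWER SHAPE IS AT LEAST GEOMETRIC: `exp(−a·Lⁿ) ≤ (e^{−a})ⁿ` for `0 ≤ a`, `2 ≤ L`
(the shape of [B12] p. 290 «B₀ exp(−δ₀M(Lʲη)⁻¹)» and (4.36) «exp(−(Lʲη)⁻¹)» with `(Lʲη)⁻¹ = L^{k−j}`). [folklore] -/
theorem exp_tower_le_geom {a L : ℝ} (ha : 0 ≤ a) (hL : 2 ≤ L) (n : ℕ) :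
    Real.exp (-(a * L ^ n)) ≤ Real.exp (-a) ^ n := by
  rw [← Real.exp_nat_mul]
  refine Real.exp_le_exp.mpr ?_
  have h : a * (n : ℝ) ≤ a * L ^ n := mul_le_mul_of_nonneg_left (natCast_le_pow hL n) ha
  linarith

/-- The tower ratio `e^{−a}` lies in `[0,1[` for `a > 0`. [folklore] -/
theorem exp_neg_lt_one {a : ℝ} (ha : 0 < a) : 0 ≤ Real.exp (-a) ∧ Real.exp (-a) < 1 := by
  refine ⟨(Real.exp_pos _).le, ?_⟩
  have h : Real.exp (-a) < Real.exp 0 := Real.exp_lt_exp.mpr (by linarith)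
  simpa using h

/-- THE POWER SHAPE IS GEOMETRIC: `(Lⁿ)^{−α} = (L^{−α})ⁿ` for `0 ≤ L` (real exponent `α`; the shape of the irrelevant
terms (0.29) «(Lʲη)^{4+α}» relative to the marginal power, `(Lʲη)^{α} = (L^{k−j})^{−α}`). [folklore] -/
theorem pow_scale_rpow_neg {L : ℝ} (hL : 0 ≤ L) (α : ℝ) (n : ℕ) :
    (L ^ n) ^ (-α) = (L ^ (-α)) ^ n := by
  rw [← Real.rpow_natCast L n, ← Real.rpow_mul hL, mul_comm, Real.rpow_mul hL, Real.rpow_natCast]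

/-- The power ratio `L^{−α}` lies in `[0,1[` for `1 < L`, `0 < α` (cf. (0.30) «(1 − L^{−α})⁻¹»). [folklore] -/
theorem rpow_neg_lt_one {L α : ℝ} (hL : 1 < L) (hα : 0 < α) : 0 ≤ L ^ (-α) ∧ L ^ (-α) < 1 :=
  ⟨Real.rpow_nonneg (by linarith) _, Real.rpow_lt_one_of_one_lt_of_neg hL (by linarith)⟩

/-! ## 2. Adapters into `SeparationRate` -/

/-- ADAPTER (tower shape): if the discrepancies of the old terms obey the printed tower shape
`|μ j k − β0 j| ≤ C exp(−a L^{k−j})` (`0 ≤ C`, `0 ≤ a`, `2 ≤ L`), then `SeparationRate C (e^{−a}) μ β0`. [folklore] -/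
theorem separationRate_of_tower {C a L : ℝ} {μ : ℕ → ℕ → ℝ} {β0 : ℕ → ℝ} (hC : 0 ≤ C) (ha : 0 ≤ a) (hL : 2 ≤ L)
    (h : ∀ j k : ℕ, j < k → |μ j k - β0 j| ≤ C * Real.exp (-(a * L ^ (k - j)))) :
    SeparationRate C (Real.exp (-a)) μ β0 := fun j k hjk =>
  (h j k hjk).trans (mul_le_mul_of_nonneg_left (exp_tower_le_geom ha hL (k - j)) hC)

/-- ADAPTER (power shape): if the discrepancies obey the printed power shape `|μ j k − β0 j| ≤ C (L^{k−j})^{−α}`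
(`0 ≤ L`), then `SeparationRate C (L^{−α}) μ β0` — an equality of shapes, no loss. [folklore] -/
theorem separationRate_of_powShape {C L α : ℝ} {μ : ℕ → ℕ → ℝ} {β0 : ℕ → ℝ} (hL : 0 ≤ L)
    (h : ∀ j k : ℕ, j < k → |μ j k - β0 j| ≤ C * (L ^ (k - j)) ^ (-α)) :
    SeparationRate C (L ^ (-α)) μ β0 := fun j k hjk => by
  have := h j k hjk
  rwa [pow_scale_rpow_neg hL α (k - j)] at this

/-- `SeparationRate` is monotone in the constant and in the ratio (`0 ≤ θ₁ ≤ θ₂`, `C₁ ≤ C₂`, `0 ≤ C₂`). [folklore] -/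
theorem separationRate_mono {C₁ C₂ θ₁ θ₂ : ℝ} {μ : ℕ → ℕ → ℝ} {β0 : ℕ → ℝ} (hθ : 0 ≤ θ₁) (hθθ : θ₁ ≤ θ₂)
    (hCC : C₁ ≤ C₂) (hC₂ : 0 ≤ C₂) (h : SeparationRate C₁ θ₁ μ β0) : SeparationRate C₂ θ₂ μ β0 := fun j k hjk => by
  have h1 := h j k hjk
  have h2 : C₁ * θ₁ ^ (k - j) ≤ C₂ * θ₁ ^ (k - j) := mul_le_mul_of_nonneg_right hCC (pow_nonneg hθ _)
  have h3 : C₂ * θ₁ ^ (k - j) ≤ C₂ * θ₂ ^ (k - j) :=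
    mul_le_mul_of_nonneg_left (pow_le_pow_left₀ hθ hθθ _) hC₂
  exact h1.trans (h2.trans h3)

/-- `SeparationRate` is ADDITIVE over two groups of terms at a common ratio: a table of named terms, each with its own
`(Cᵢ, θ)`, assembles into one `SeparationRate (ΣCᵢ) θ` for the summed family (iterate this lemma; bring the ratios to a
common `θ = max θᵢ` first with `separationRate_mono`). [folklore] -/
theorem separationRate_add {C₁ C₂ θ : ℝ} {μ₁ μ₂ : ℕ → ℕ → ℝ} {β₁ β₂ : ℕ → ℝ}
    (h₁ : SeparationRate C₁ θ μ₁ β₁) (h₂ : SeparationRate C₂ θ μ₂ β₂) :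
    SeparationRate (C₁ + C₂) θ (fun j k => μ₁ j k + μ₂ j k) (fun j => β₁ j + β₂ j) := fun j k hjk => by
  have e : μ₁ j k + μ₂ j k - (β₁ j + β₂ j) = (μ₁ j k - β₁ j) + (μ₂ j k - β₂ j) := by ring
  rw [e, add_mul]
  exact (abs_add_le _ _).trans (add_le_add (h₁ j k hjk) (h₂ j k hjk))

/-- A group of terms with NO discrepancy (an exact identity, e.g. the counterterm's (4.40) after the same replacements,
or any term typed through `MarginalTelescoping.IdentityForm`) contributes `SeparationRate 0 θ` at every ratio. [folklore] -/
theorem separationRate_zero_of_eq {θ : ℝ} {μ : ℕ → ℕ → ℝ} {β0 : ℕ → ℝ} (h : ∀ j k : ℕ, j < k → μ j k = β0 j) :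
    SeparationRate 0 θ μ β0 := fun j k hjk => by
  simp [h j k hjk]

/-! ## 3. The uniform-in-`k` sums over `j` («a uniform bound is clear», [B12] p. 298 l. 14, said of the transformed
fluctuation-field action; contrast p. 292 l. 2–5 on the marginal terms (4.42), (4.44): «for which the sum over j has not
a uniform bound») -/

/-- Tower shape summed over the old scales: `Σ_{j<k} C exp(−a L^{k−j}) ≤ C · e^{−a}/(1 − e^{−a})`, uniformly in `k`
(`0 ≤ C`, `0 < a`, `2 ≤ L`). [folklore] -/
theorem sum_tower_le {C a L : ℝ} (hC : 0 ≤ C) (ha : 0 < a) (hL : 2 ≤ L) (k : ℕ) :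
    ∑ j ∈ range k, C * Real.exp (-(a * L ^ (k - j))) ≤ C * (Real.exp (-a) / (1 - Real.exp (-a))) := by
  obtain ⟨h0, h1⟩ := exp_neg_lt_one ha
  calc ∑ j ∈ range k, C * Real.exp (-(a * L ^ (k - j)))
      ≤ ∑ j ∈ range k, C * Real.exp (-a) ^ (k - j) :=
        sum_le_sum fun j _ => mul_le_mul_of_nonneg_left (exp_tower_le_geom ha.le hL (k - j)) hC
    _ = C * ∑ j ∈ range k, Real.exp (-a) ^ (k - j) := by rw [mul_sum]
    _ ≤ C * (Real.exp (-a) / (1 - Real.exp (-a))) := mul_le_mul_of_nonneg_left (sum_pow_sub_le h0 h1 k) hC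

/-- Power shape summed over the old scales: `Σ_{j<k} C (L^{k−j})^{−α} ≤ C · L^{−α}/(1 − L^{−α})`, uniformly in `k`
(`0 ≤ C`, `1 < L`, `0 < α`; (0.30)'s «(1 − L^{−α})⁻¹» up to the `j = k` term). [folklore] -/
theorem sum_powShape_le {C L α : ℝ} (hC : 0 ≤ C) (hL : 1 < L) (hα : 0 < α) (k : ℕ) :
    ∑ j ∈ range k, C * (L ^ (k - j)) ^ (-α) ≤ C * (L ^ (-α) / (1 - L ^ (-α))) := by
  obtain ⟨h0, h1⟩ := rpow_neg_lt_one hL hα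
  have hL0 : 0 ≤ L := by linarith
  calc ∑ j ∈ range k, C * (L ^ (k - j)) ^ (-α)
      = C * ∑ j ∈ range k, (L ^ (-α)) ^ (k - j) := by
        rw [mul_sum]; exact sum_congr rfl fun j _ => by rw [pow_scale_rpow_neg hL0 α (k - j)]
    _ ≤ C * (L ^ (-α) / (1 - L ^ (-α))) := mul_le_mul_of_nonneg_left (sum_pow_sub_le h0 h1 k) hC

/-- THE (O4) ASSEMBLY SHAPE.  Two groups of old-term discrepancies — one in the printed tower shape (the replacements
`H_j(□₀) → H_j`, the domain extensions (4.36)), one in the printed power shape (irrelevant terms, (0.29)) — give ONE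
`SeparationRate` for the summed family at the ratio `max(e^{−a}, L^{−α}) < 1`; this is the exact input shape of
`ComposedRoad.oneLoopDrift_of_composedWindow` / `DriftRemainder`'s (A-ps) consumers.  All three analytic inputs are
binders. [folklore] -/
theorem separationRate_of_tower_add_powShape {C₁ C₂ a L α : ℝ} {μ₁ μ₂ : ℕ → ℕ → ℝ} {β₁ β₂ : ℕ → ℝ}
    (hC₁ : 0 ≤ C₁) (hC₂ : 0 ≤ C₂) (ha : 0 < a) (hL : 2 ≤ L) (hα : 0 < α)
    (h₁ : ∀ j k : ℕ, j < k → |μ₁ j k - β₁ j| ≤ C₁ * Real.exp (-(a * L ^ (k - j))))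
    (h₂ : ∀ j k : ℕ, j < k → |μ₂ j k - β₂ j| ≤ C₂ * (L ^ (k - j)) ^ (-α)) :
    SeparationRate (C₁ + C₂) (max (Real.exp (-a)) (L ^ (-α)))
      (fun j k => μ₁ j k + μ₂ j k) (fun j => β₁ j + β₂ j) ∧
    0 ≤ max (Real.exp (-a)) (L ^ (-α)) ∧ max (Real.exp (-a)) (L ^ (-α)) < 1 := by
  obtain ⟨e0, e1⟩ := exp_neg_lt_one ha
  obtain ⟨p0, p1⟩ := rpow_neg_lt_one (by linarith : (1 : ℝ) < L) hα
  have s₁ : SeparationRate C₁ (max (Real.exp (-a)) (L ^ (-α))) μ₁ β₁ :=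
    separationRate_mono e0 (le_max_left _ _) le_rfl hC₁ (separationRate_of_tower hC₁ ha.le hL h₁)
  have s₂ : SeparationRate C₂ (max (Real.exp (-a)) (L ^ (-α))) μ₂ β₂ :=
    separationRate_mono p0 (le_max_right _ _) le_rfl hC₂ (separationRate_of_powShape (by linarith) h₂)
  exact ⟨separationRate_add s₁ s₂, le_max_of_le_left e0, max_lt e1 p1⟩

end Literature.MathematicalPhysics.QuantumFieldTheory.Balaban1983to89.Beta.ReplacementRates
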